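import Summits.QuantumAdvantage.QuantumAdvantage.Theorems.RankDialE1
import Literature.NumberTheory.EllipticCurves.BinaryQuarticDiscriminantFpCountProofs
import HarnessLib

/-!
# RankDial (E2) — part E continued: §9 the class alternating sums `altC` (recursion, closed form, unique zero) and §10 `ExactRankBound p` / `PureClassBound p` for every prime `p ≠ 3`

TARGET BY NAME (cell decomp-qadv, RESIDUAL MODE): item stmt-QuantumAdvantage-23109
`Summit.QuantumAdvantage.QuantumAdvantage.Theses.OddPrimeWalk.ManyReadersSqrtOdd`, through rung R5 = `AdviceFreeQNC0.WalkHardFLinSel p`.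
This file SUPPORTS the item (`--supports`); it does not close it.  Declaration bodies are byte-identical to the cell node
«OlsonDial» (decomp-qadv lens-1 «grading / quantitative ladder», generation 26; node file sha256 6d975657…), cut into
≤ 400-line parts E1 (§7–§8) → E2 (§9–§10) → F1 (§11, §11bis) → F2 (§11ter) → F3 (§12); see part E1 for the whole node.
-/

set_option linter.dupNamespace false
set_option autoImplicit false

noncomputable section
open Classical

namespace Summit.QuantumAdvantage.QuantumAdvantage.Theorems.RankDial

open Finset
open Summit.QuantumAdvantage.AdviceFreeQNC0
open Literature.Computability.MetaComplexity Literature.Computability.MetaComplexity.Smolensky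

/-! ### §9 The alternating sums of the three weight classes: recursion and closed form -/

section ClassSums
variable (F : Type*) [Field F]

/-- `A_ℓ(b) = Σ_{v ∈ {0,1}^ℓ, |v| ≡ b (mod 3)} (−1)^{|v|}`. -/
def altC (ℓ b : ℕ) : F :=
  ∑ v ∈ univ.filter (fun v : Fin ℓ → Bool => wt v % 3 = b % 3), (-1 : F) ^ wt v

/-- the odd pattern `(1, −1, 0)` -/
def pat1 (s : ℕ) : F := if s = 0 then 1 else if s = 1 then -1 else 0

/-- the even pattern `(1, −2, 1)` -/
def pat2 (s : ℕ) : F := if s = 0 then 1 else if s = 1 then -2 else 1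

variable {F}

/-- `A_0(b) = [b ≡ 0]`. -/
theorem altC_zero (b : ℕ) : altC F 0 b = if b % 3 = 0 then 1 else 0 := by
  unfold altC
  have hw : ∀ v : Fin 0 → Bool, wt v = 0 := fun v => by simp [wt]
  rw [Finset.sum_filter, Fintype.sum_unique, hw, Nat.zero_mod, pow_zero]
  by_cases hb : b % 3 = 0
  · rw [if_pos hb.symm, if_pos hb]
  · rw [if_neg (fun h => hb h.symm), if_neg hb]

/-- **Recursion** `A_{ℓ+1}(b) = A_ℓ(b) − A_ℓ(b+2)` (first coordinate `0` / `1`). -/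
theorem altC_succ (ℓ b : ℕ) : altC F (ℓ + 1) b = altC F ℓ b - altC F ℓ (b + 2) := by
  unfold altC
  rw [Finset.sum_filter, Finset.sum_filter, Finset.sum_filter, sum_cube_succ]
  have h1 : ∀ x : Fin ℓ → Bool,
      (if wt (Fin.cons true x : Fin (ℓ + 1) → Bool) % 3 = b % 3 then
          (-1 : F) ^ wt (Fin.cons true x : Fin (ℓ + 1) → Bool) else 0) =
        -(if wt x % 3 = (b + 2) % 3 then (-1 : F) ^ wt x else 0) := by
    intro x
    rw [wt_cons_true]
    have hiff : (wt x + 1) % 3 = b % 3 ↔ wt x % 3 = (b + 2) % 3 := by omega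
    by_cases hx : wt x % 3 = (b + 2) % 3
    · rw [if_pos (hiff.2 hx), if_pos hx, pow_succ]
      ring
    · rw [if_neg (fun h => hx (hiff.1 h)), if_neg hx, neg_zero]
  have h2 : ∀ x : Fin ℓ → Bool,
      (if wt (Fin.cons false x : Fin (ℓ + 1) → Bool) % 3 = b % 3 then
          (-1 : F) ^ wt (Fin.cons false x : Fin (ℓ + 1) → Bool) else 0) =
        (if wt x % 3 = b % 3 then (-1 : F) ^ wt x else 0) := by
    intro x
    rw [wt_cons_false]
  rw [Finset.sum_congr rfl (fun x _ => h1 x), Finset.sum_congr rfl (fun x _ => h2 x), Finset.sum_neg_distrib]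
  ring

/-- pattern identity for `A_1` -/
theorem pat_i0 (F : Type*) [Field F] (s : ℕ) (hs : s < 3) :
    (if s = 0 then (1 : F) else 0) - (if (s + 2) % 3 = 0 then (1 : F) else 0) = pat1 F s := by
  interval_cases s <;> norm_num [pat1]

/-- pattern identity odd → even -/
theorem pat_i1 (F : Type*) [Field F] (s : ℕ) (hs : s < 3) : pat1 F s - pat1 F ((s + 2) % 3) = pat2 F s := by
  interval_cases s <;> norm_num [pat1, pat2]

/-- pattern identity even → odd -/
theorem pat_i2 (F : Type*) [Field F] (s : ℕ) (hs : s < 3) :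
    pat2 F s - pat2 F ((s + 2) % 3) = -3 * pat1 F ((s + 2) % 3) := by
  interval_cases s <;> norm_num [pat1, pat2]

/-- `A_1 = (1, −1, 0)`. -/
theorem altC_one (b : ℕ) : altC F 1 b = pat1 F (b % 3) := by
  show altC F (0 + 1) b = pat1 F (b % 3)
  rw [altC_succ, altC_zero, altC_zero, show (b + 2) % 3 = (b % 3 + 2) % 3 by omega]
  exact pat_i0 F (b % 3) (Nat.mod_lt _ (by norm_num))

/-- `A_2 = (1, −2, 1)`. -/
theorem altC_two (b : ℕ) : altC F 2 b = pat2 F (b % 3) := by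
  show altC F (1 + 1) b = pat2 F (b % 3)
  rw [altC_succ, altC_one, altC_one, show (b + 2) % 3 = (b % 3 + 2) % 3 by omega]
  exact pat_i1 F (b % 3) (Nat.mod_lt _ (by norm_num))

/-- **Closed form**: `A_{2m+1}(b) = (−3)^m·pat1((b+2m) mod 3)` and `A_{2m+2}(b) = (−3)^m·pat2((b+2m) mod 3)`. -/
theorem altC_closed (m : ℕ) :
    (∀ b, altC F (2 * m + 1) b = (-3 : F) ^ m * pat1 F ((b + 2 * m) % 3)) ∧
      (∀ b, altC F (2 * m + 2) b = (-3 : F) ^ m * pat2 F ((b + 2 * m) % 3)) := by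
  induction m with
  | zero =>
    refine ⟨fun b => ?_, fun b => ?_⟩
    · rw [Nat.mul_zero, Nat.zero_add, Nat.add_zero, pow_zero, one_mul]
      exact altC_one b
    · rw [Nat.mul_zero, Nat.zero_add, Nat.add_zero, pow_zero, one_mul]
      exact altC_two b
  | succ m ih =>
    obtain ⟨_, ih2⟩ := ih
    have h1 : ∀ b, altC F (2 * (m + 1) + 1) b = (-3 : F) ^ (m + 1) * pat1 F ((b + 2 * (m + 1)) % 3) := by
      intro b
      rw [show 2 * (m + 1) + 1 = (2 * m + 2) + 1 by ring, altC_succ, ih2, ih2,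
        show (b + 2 + 2 * m) % 3 = ((b + 2 * m) % 3 + 2) % 3 by omega,
        show (b + 2 * (m + 1)) % 3 = ((b + 2 * m) % 3 + 2) % 3 by omega, ← mul_sub,
        pat_i2 F ((b + 2 * m) % 3) (Nat.mod_lt _ (by norm_num)), pow_succ]
      ring
    refine ⟨h1, fun b => ?_⟩
    rw [show 2 * (m + 1) + 2 = (2 * (m + 1) + 1) + 1 by ring, altC_succ, h1, h1,
      show (b + 2 + 2 * (m + 1)) % 3 = ((b + 2 * (m + 1)) % 3 + 2) % 3 by omega, ← mul_sub,
      pat_i1 F ((b + 2 * (m + 1)) % 3) (Nat.mod_lt _ (by norm_num))]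

/-- **Some class has a non-zero alternating sum** (when `3 ≠ 0` in `F`). -/
theorem exists_altC_ne_zero (h3 : (3 : F) ≠ 0) (ℓ : ℕ) : ∃ b, altC F ℓ b ≠ 0 := by
  have hm3 : ∀ m : ℕ, (-3 : F) ^ m ≠ 0 := fun m => pow_ne_zero _ (neg_ne_zero.mpr h3)
  obtain ⟨m, rfl | rfl⟩ := Nat.even_or_odd' ℓ
  · cases m with
    | zero =>
      refine ⟨0, ?_⟩
      rw [Nat.mul_zero, altC_zero, if_pos rfl]
      exact one_ne_zero
    | succ m =>
      refine ⟨m, ?_⟩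
      rw [show 2 * (m + 1) = 2 * m + 2 by ring, (altC_closed m).2 m, show (m + 2 * m) % 3 = 0 by omega,
        show pat2 F 0 = 1 by simp [pat2], mul_one]
      exact hm3 m
  · refine ⟨m, ?_⟩
    rw [(altC_closed m).1 m, show (m + 2 * m) % 3 = 0 by omega, show pat1 F 0 = 1 by simp [pat1], mul_one]
    exact hm3 m

/-- **At most one class has alternating sum zero** (`ℓ ≥ 1`, `3 ≠ 0` in `F`). -/
theorem altC_zero_unique (h3 : (3 : F) ≠ 0) {ℓ : ℕ} (hℓ : 1 ≤ ℓ) {b b' : ℕ} (hb : altC F ℓ b = 0)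
    (hb' : altC F ℓ b' = 0) : b % 3 = b' % 3 := by
  have hm3 : ∀ m : ℕ, (-3 : F) ^ m ≠ 0 := fun m => pow_ne_zero _ (neg_ne_zero.mpr h3)
  obtain ⟨m, rfl | rfl⟩ := Nat.even_or_odd' ℓ
  · obtain ⟨m, rfl⟩ : ∃ m', m = m' + 1 := ⟨m - 1, by omega⟩
    rw [show 2 * (m + 1) = 2 * m + 2 by ring, (altC_closed m).2] at hb hb'
    have key : ∀ c : ℕ, (-3 : F) ^ m * pat2 F ((c + 2 * m) % 3) = 0 → (c + 2 * m) % 3 = 1 := by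
      intro c hc
      have hz := (mul_eq_zero.1 hc).resolve_left (hm3 m)
      have hs : (c + 2 * m) % 3 < 3 := Nat.mod_lt _ (by norm_num)
      generalize (c + 2 * m) % 3 = s at hz hs
      interval_cases s
      · simp [pat2] at hz
      · rfl
      · simp [pat2] at hz
    have h1 := key b hb
    have h2 := key b' hb'
    omega
  · rw [(altC_closed m).1] at hb hb'
    have key : ∀ c : ℕ, (-3 : F) ^ m * pat1 F ((c + 2 * m) % 3) = 0 → (c + 2 * m) % 3 = 2 := by
      intro c hc
      have hz := (mul_eq_zero.1 hc).resolve_left (hm3 m)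
      have hs : (c + 2 * m) % 3 < 3 := Nat.mod_lt _ (by norm_num)
      generalize (c + 2 * m) % 3 = s at hz hs
      interval_cases s
      · simp [pat1] at hz
      · simp [pat1] at hz
      · rfl
    have h1 := key b hb
    have h2 := key b' hb'
    omega

end ClassSums

/-! ### §10 `ExactRankBound p` and `PureClassBound p` for every prime `p ≠ 3` -/

section Exact
variable {p : ℕ} [Fact p.Prime]

/-- **A pure class has alternating sum zero.**  If `ℓ > d(p−1)` and the weight class `b mod 3` of `{0,1}^ℓ` is a union
of fibres of a `d`-row sketch (membership decided by a predicate of `Φv`), then `A_ℓ(b) = 0` in `𝔽_p`. -/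
theorem altC_eq_zero_of_pure {d ℓ : ℕ} (hℓ : d * (p - 1) < ℓ) (Φ : Fin d → Fin ℓ → ZMod p)
    (P : (Fin d → ZMod p) → Prop) (b : ℕ) (hpure : ∀ v : Fin ℓ → Bool, P (skt Φ v) ↔ wt v % 3 = b % 3) :
    altC (ZMod p) ℓ b = 0 := by
  haveI : NeZero p := ⟨(Fact.out : p.Prime).ne_zero⟩
  unfold altC
  have hset : (univ.filter fun v : Fin ℓ → Bool => wt v % 3 = b % 3) = univ.filter fun v => P (skt Φ v) :=
    Finset.filter_congr fun v _ => (hpure v).symm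
  rw [hset, ← Finset.sum_fiberwise (univ.filter fun v : Fin ℓ → Bool => P (skt Φ v)) (skt Φ)
    (fun v => (-1 : ZMod p) ^ wt v)]
  refine Finset.sum_eq_zero fun x _ => ?_
  by_cases hx : P x
  · have hfib : ((univ.filter fun v : Fin ℓ → Bool => P (skt Φ v)).filter fun v => skt Φ v = x) =
        univ.filter fun v => skt Φ v = x := by
      rw [Finset.filter_filter]
      exact Finset.filter_congr fun v _ => ⟨fun h => h.2, fun h => ⟨by rw [h]; exact hx, h⟩⟩
    rw [hfib]
    exact olson_altSum hℓ Φ x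
  · refine Finset.sum_eq_zero fun v hv => ?_
    rw [Finset.mem_filter, Finset.mem_filter] at hv
    exact absurd (hv.2 ▸ hv.1.2) hx

/-- **THEOREM (the open rung of part A, decided): `ExactRankBound p` holds for every prime `p ≠ 3`.**  A `d`-row
`𝔽_p`-sketch through which `|v| mod 3` factors exactly on `{0,1}^ℓ` has `ℓ ≤ (p−1)·d` — for EVERY `d` (part A had it
machine-checked for six `(p,d)` only); tight by `exactRankBound_tight` (the block sketch), false at `p = 3`
(`not_exactRankBound_three`). -/
theorem exactRankBound_holds (p : ℕ) [Fact p.Prime] (hp3 : p ≠ 3) : ExactRankBound p := by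
  intro ℓ d Φ G hG
  by_contra hle
  have hℓ : d * (p - 1) < ℓ := by
    rw [Nat.mul_comm]
    exact not_le.1 hle
  have hz : ∀ b, altC (ZMod p) ℓ b = 0 := fun b =>
    altC_eq_zero_of_pure hℓ Φ (fun x => G x = b % 3) b (fun v => by
      show G (skt Φ v) = b % 3 ↔ wt v % 3 = b % 3
      rw [show G (skt Φ v) = wt v % 3 from hG v])
  obtain ⟨b, hb⟩ := exists_altC_ne_zero (Literature.NumberTheory.EllipticCurves.BinaryQuartic.three_ne_zero_zmod hp3) ℓ
  exact hb (hz b)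

/-- hence for every odd prime `p ≥ 5` (the primes of rung R5). -/
theorem exactRankBound_odd (p : ℕ) [Fact p.Prime] (hp : 5 ≤ p) : ExactRankBound p :=
  exactRankBound_holds p (by omega)

/-- **`p ≠ 3` is necessary**: at `p = 3` the weight mod 3 IS one linear form, `¬ ExactRankBound 3`. -/
theorem not_exactRankBound_three : ¬ ExactRankBound 3 := by
  intro h
  haveI : Fact (Nat.Prime 3) := ⟨Nat.prime_three⟩
  have h3 := h 3 1 (fun _ _ => 1) (fun x => (x 0).val) (fun v => by
    show (∑ j, if v j then (1 : ZMod 3) else 0).val = wt v % 3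
    rw [Finset.sum_boole, ZMod.val_natCast]
    rfl)
  omega

/-- **Olson–Davenport with a mod-3 side condition** (the `δ`-form of `ExactRankBound`): `ℓ > (p−1)d` columns
`φ_j ∈ 𝔽_p^d` always admit `u, w ∈ {0,1}^ℓ` with `Φu = Φw` and `|u| ≢ |w| (mod 3)` — a signed relation
`Σ_j δ_j φ_j = 0`, `δ = u − w ∈ {0,±1}^ℓ`, with `Σ_j δ_j ≢ 0 (mod 3)`. -/
theorem exists_collision (p : ℕ) [Fact p.Prime] (hp3 : p ≠ 3) {d ℓ : ℕ} (hℓ : (p - 1) * d < ℓ)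
    (Φ : Fin d → Fin ℓ → ZMod p) :
    ∃ u w : Fin ℓ → Bool, skt Φ u = skt Φ w ∧ wt u % 3 ≠ wt w % 3 := by
  by_contra hne
  have h : ∀ u w : Fin ℓ → Bool, skt Φ u = skt Φ w → wt u % 3 = wt w % 3 := fun u w huw => by
    by_contra h3
    exact hne ⟨u, w, huw, h3⟩
  have hG : ∃ G : (Fin d → ZMod p) → ℕ, ∀ v : Fin ℓ → Bool, G (skt Φ v) = wt v % 3 := by
    refine ⟨fun x => if hx : ∃ v : Fin ℓ → Bool, skt Φ v = x then wt (Classical.choose hx) % 3 else 0,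
      fun v => ?_⟩
    have hx : ∃ v' : Fin ℓ → Bool, skt Φ v' = skt Φ v := ⟨v, rfl⟩
    show (if hx : ∃ v' : Fin ℓ → Bool, skt Φ v' = skt Φ v then wt (Classical.choose hx) % 3 else 0) = wt v % 3
    rw [dif_pos hx]
    exact h _ _ (Classical.choose_spec hx)
  obtain ⟨G, hG⟩ := hG
  exact absurd (exactRankBound_holds p hp3 ℓ d Φ G hG) (not_le.2 hℓ)

/-- **`PureClassBound p`** — the ONE-CLASS refinement: if the indicator of a single weight class `{|v| ≡ b (mod 3)}`
of `{0,1}^ℓ` factors exactly through a `d`-row `𝔽_p`-sketch (is a level set of some `G : 𝔽_p^d → Bool`), then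
`ℓ ≤ (p−1)·d + 1`.  [PROVED for every prime `p ≠ 3` (`pureClassBound_holds`); TIGHT at `d = 1` (`pureClassBound_tight`:
`ℓ = p`, `Φ = 𝟙`, the class `2p mod 3` misses both colliding weights `0` and `p`); FALSE at `p = 3`.  It is the
`ε = 0` end of the quantitative law `EquiRank` (one level set carrying a whole class), one step above `ExactRankBound`.] -/
def PureClassBound (p : ℕ) : Prop :=
  ∀ (ℓ d : ℕ) (Φ : Fin d → Fin ℓ → ZMod p) (G : (Fin d → ZMod p) → Bool) (b : ℕ),
    (∀ v : Fin ℓ → Bool, G (fun k => ∑ j, if v j then Φ k j else 0) = true ↔ wt v % 3 = b % 3) →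
      ℓ ≤ (p - 1) * d + 1

/-- the tail sketch (drop column `0`) -/
def tailSkt {d ℓ : ℕ} (Φ : Fin d → Fin (ℓ + 1) → ZMod p) : Fin d → Fin ℓ → ZMod p := fun k j => Φ k j.succ

/-- slicing the sketch map at `x₀ = 0` -/
theorem skt_cons_false {d ℓ : ℕ} (Φ : Fin d → Fin (ℓ + 1) → ZMod p) (x : Fin ℓ → Bool) :
    skt Φ (Fin.cons false x) = skt (tailSkt Φ) x := by
  funext k
  simp only [skt, tailSkt, Fin.sum_univ_succ, Fin.cons_zero, Fin.cons_succ, Bool.false_eq_true, if_false, zero_add]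

/-- slicing the sketch map at `x₀ = 1` -/
theorem skt_cons_true {d ℓ : ℕ} (Φ : Fin d → Fin (ℓ + 1) → ZMod p) (x : Fin ℓ → Bool) :
    skt Φ (Fin.cons true x) = fun k => Φ k 0 + skt (tailSkt Φ) x k := by
  funext k
  simp only [skt, tailSkt, Fin.sum_univ_succ, Fin.cons_zero, Fin.cons_succ, if_true]

/-- **THEOREM: `PureClassBound p` holds for every prime `p ≠ 3`.**  Slice along coordinate `0`: on `x₀ = 0` the class
`b` of the `(ℓ−1)`-cube is pure through the tail sketch, on `x₀ = 1` the class `b + 2` is (through the shifted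
predicate); for `ℓ − 1 > (p−1)d` both have alternating sum zero, contradicting `altC_zero_unique`. -/
theorem pureClassBound_holds (p : ℕ) [Fact p.Prime] (hp3 : p ≠ 3) : PureClassBound p := by
  intro ℓ d Φ G b hG
  by_contra hle
  have hlt : (p - 1) * d + 1 < ℓ := not_le.1 hle
  obtain ⟨ℓ, rfl⟩ : ∃ ℓ', ℓ = ℓ' + 1 := ⟨ℓ - 1, by omega⟩
  have hℓ : d * (p - 1) < ℓ := by
    rw [Nat.mul_comm] at hlt
    omega
  have h0 : altC (ZMod p) ℓ b = 0 :=
    altC_eq_zero_of_pure hℓ (tailSkt Φ) (fun y => G y = true) b (fun x => by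
      have h := hG (Fin.cons false x)
      change G (skt Φ (Fin.cons false x)) = true ↔ _ at h
      rw [skt_cons_false, wt_cons_false] at h
      exact h)
  have h2 : altC (ZMod p) ℓ (b + 2) = 0 :=
    altC_eq_zero_of_pure hℓ (tailSkt Φ) (fun y => G (fun k => Φ k 0 + y k) = true) (b + 2) (fun x => by
      have h := hG (Fin.cons true x)
      change G (skt Φ (Fin.cons true x)) = true ↔ _ at h
      rw [skt_cons_true, wt_cons_true] at h
      show G (fun k => Φ k 0 + skt (tailSkt Φ) x k) = true ↔ wt x % 3 = (b + 2) % 3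
      rw [h]
      omega)
  have hu := altC_zero_unique (Literature.NumberTheory.EllipticCurves.BinaryQuartic.three_ne_zero_zmod hp3) (show 1 ≤ ℓ by omega) h0 h2
  omega

/-- hence for every odd prime `p ≥ 5`. -/
theorem pureClassBound_odd (p : ℕ) [Fact p.Prime] (hp : 5 ≤ p) : PureClassBound p :=
  pureClassBound_holds p (by omega)

/-- **`PureClassBound` is TIGHT at `d = 1`**: `ℓ = p = (p−1)·1 + 1`, `Φ = 𝟙` (so `Φv = |v| mod p`), and the class
`b = 2p mod 3`, which contains neither of the two colliding weights `0` and `p`, IS a level set. -/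
theorem pureClassBound_tight (p : ℕ) [Fact p.Prime] (hp3 : p ≠ 3) :
    ∃ (Φ : Fin 1 → Fin p → ZMod p) (G : (Fin 1 → ZMod p) → Bool) (b : ℕ),
      ∀ v : Fin p → Bool, G (fun k => ∑ j, if v j then Φ k j else 0) = true ↔ wt v % 3 = b % 3 := by
  have hp : p.Prime := Fact.out
  have hp3' : p % 3 ≠ 0 := fun h =>
    hp3 ((Nat.prime_dvd_prime_iff_eq Nat.prime_three hp).1 (Nat.dvd_of_mod_eq_zero h)).symm
  refine ⟨fun _ _ => 1, fun x => decide (x 0 ≠ 0 ∧ (x 0).val % 3 = 2 * p % 3), 2 * p, fun v => ?_⟩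
  have hs : (∑ j, if v j then (1 : ZMod p) else 0) = (wt v : ZMod p) := by
    rw [Finset.sum_boole]
    rfl
  show decide ((∑ j, if v j then (1 : ZMod p) else 0) ≠ 0 ∧
      (∑ j, if v j then (1 : ZMod p) else 0).val % 3 = 2 * p % 3) = true ↔ wt v % 3 = 2 * p % 3
  rw [hs, decide_eq_true_iff]
  have hle : wt v ≤ p := by
    unfold wt
    exact (Finset.card_filter_le _ _).trans (by simp)
  rcases hle.lt_or_eq with hlt | heq
  · have hz : (wt v : ZMod p) ≠ 0 ↔ wt v ≠ 0 := by
      rw [Ne, ZMod.natCast_eq_zero_iff]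
      exact ⟨fun h h0 => h (h0 ▸ dvd_zero p), fun h hd => h (Nat.eq_zero_of_dvd_of_lt hd hlt)⟩
    rw [ZMod.val_cast_of_lt hlt, hz]
    omega
  · rw [heq, ZMod.natCast_self]
    simp only [ne_eq, not_true_eq_false, false_and, false_iff]
    omega

/-- **`p ≠ 3` is necessary** here too: `¬ PureClassBound 3` (`Φ = 𝟙` on `ℓ = 4 > (3−1)·1 + 1` coordinates). -/
theorem not_pureClassBound_three : ¬ PureClassBound 3 := by
  intro h
  haveI : Fact (Nat.Prime 3) := ⟨Nat.prime_three⟩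
  have h3 := h 4 1 (fun _ _ => 1) (fun x => decide (x 0 = 0)) 0 (fun v => by
    show decide ((∑ j, if v j then (1 : ZMod 3) else 0) = 0) = true ↔ wt v % 3 = 0 % 3
    rw [decide_eq_true_iff, Finset.sum_boole, ZMod.natCast_eq_zero_iff, Nat.zero_mod]
    show 3 ∣ wt v ↔ wt v % 3 = 0
    omega)
  omega

/-- **THE ALGEBRAIC END OF THE RANK DIAL** (all four entries kernel theorems; `p` prime, `p ≠ 3`):
exact factorisation of `|v| mod 3` through a `d`-row sketch ⟺ `ℓ ≤ (p−1)d` is possible (holds at `ℓ = (p−1)d` by the block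
sketch, fails above), and one pure class forces `ℓ ≤ (p−1)d + 1`. -/
theorem rank_dial_algebraic (p : ℕ) [Fact p.Prime] (hp3 : p ≠ 3) :
    ExactRankBound p ∧ PureClassBound p ∧
      (∀ m : ℕ, ∃ (Φ : Fin m → Fin (m * (p - 1)) → ZMod p) (G : (Fin m → ZMod p) → ℕ),
        ∀ v : Fin (m * (p - 1)) → Bool, G (fun k => ∑ j, if v j then Φ k j else 0) = wt v % 3) := by
  haveI : NeZero p := ⟨(Fact.out : p.Prime).ne_zero⟩
  exact ⟨exactRankBound_holds p hp3, pureClassBound_holds p hp3,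
    fun m => exactRankBound_tight p (Fact.out : p.Prime).two_le m⟩

end Exact

end Summit.QuantumAdvantage.QuantumAdvantage.Theorems.RankDial

end
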